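import Mathlib
import Literature.Probability.Process.PointStationaryTransfer
import Literature.Probability.Process.RootedHardCoreConfig
import Literature.MathematicalPhysics.StatisticalMechanics.BarlowStacking

/-!
# `ChartedPlanarOrder` · crux `ChartedZeroExcessLayered` (stmt-AtomisticToContinuum-26636) · line «symmetric-straightening»
# — the registered stub `stub_everyPointOfRoot`, PROVED

decomp-a2c · lens-3 · generation 11 (planner seat `decomp-a2c-lens-3-g11`, 2026-08-30); critic rule ν(ii)(a)
(CRITIC-LEDGER rows 95/98: «stub_everyPointOfRoot is LANDED» is one of the two conditions before any further
re-cut of N = `ChartedZeroExcessLayered`).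

CONTENT.  `stub_everyPointOfRoot` is VERBATIM the statement of the registered stub
`Summit.AtomisticToContinuum.Crystallization.Cruxes.ChartedZeroExcessLayered.SymmetricStraightening.stub_everyPointOfRoot`
(skeleton `Lines/birth.lean` of stmt-26636, sha256 ccd1bb01efaba268…): for a probability law `P` on configurations
that is carried by rooted `δ`-separated counting measures and satisfies the Mecke / mass-transport identity, if the
ROOT-defect event «the configuration is not `η`-matched, inside radius `3a` (points → pattern) and `4a`
(pattern → points), to a flexible-gap layered Barlow pattern `S(A,a,s,z)` centred at the root» is `P`-null, then
`P`-a.s. EVERY point `q` of the configuration is `η`-matched (same radii, pattern centred at `q`).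

PROOF.  Aldous–Lyons «everything shows at the root» in Mecke form — the ROUTE-INDEPENDENT Literature engine
`Literature.Probability.Process.IsPointStationaryLaw.ae_forall_map_sub` (PointStationaryTransfer.lean; local finiteness
of the norm shells from the hard core via `LocalConfig.finite_inter_of_separated`) — applied to the root-matching
property, followed by the translation covariance of the matching clauses: `(θ_q μ){y} = μ{y + q}`
(`Measure.map_apply`), `dist y (y' + q) = dist (y − q) y'`.  No new definitions; no Theses import (theses-cone clean);
axioms standard.  The lead of the line closes the stub by `exact Theorems.ChartedPlanarOrderEveryPointOfRoot.stub_everyPointOfRoot`.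
-/

namespace Summit.AtomisticToContinuum.Crystallization.Theorems.ChartedPlanarOrderEveryPointOfRoot

open MeasureTheory

/-- **Everything shows at the root, for `η`-matching to flexible-gap layered patterns** (= `stub_everyPointOfRoot` of
line «symmetric-straightening» on stmt-AtomisticToContinuum-26636, verbatim): a `P`-null root-defect event is null at
every point, `P`-a.s. [AldousLyons2007, Lemma 2.3; engine `IsPointStationaryLaw.ae_forall_map_sub`] -/
theorem stub_everyPointOfRoot :
    ∀ δ : ℝ, 0 < δ → ∀ P : MeasureTheory.Measure (MeasureTheory.Measure (EuclideanSpace ℝ (Fin 3))), MeasureTheory.IsProbabilityMeasure P → (∀ᵐ μ ∂P, (∃ S : Set (EuclideanSpace ℝ (Fin 3)), (0 : EuclideanSpace ℝ (Fin 3)) ∈ S ∧ (∀ x ∈ S, ∀ y ∈ S, x ≠ y → δ ≤ dist x y) ∧ μ = (MeasureTheory.Measure.count : MeasureTheory.Measure (EuclideanSpace ℝ (Fin 3))).restrict S)) → (∀ g : MeasureTheory.Measure (EuclideanSpace ℝ (Fin 3)) → EuclideanSpace ℝ (Fin 3) → ENNReal, Measurable (Function.uncurry g) → ∫⁻ μ,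 ∫⁻ y, g μ y ∂μ ∂P = ∫⁻ μ, ∫⁻ y, g (MeasureTheory.Measure.map (fun z => z - y) μ) (-y) ∂μ ∂P) → ∀ a : ℝ, 0 < a → ∀ η : ℝ, 0 < η → P {μ : MeasureTheory.Measure (EuclideanSpace ℝ (Fin 3)) | ¬ (∃ (A : EuclideanSpace ℝ (Fin 3) →ₗᵢ[ℝ] EuclideanSpace ℝ (Fin 3)) (s : ℤ → ℤ) (z : ℤ → ℝ), Literature.MathematicalPhysics.StatisticalMechanics.IsHaggSeq s ∧ (∀ m : ℤ, 39 / 50 * a ≤ z (m + 1) - z m ∧ z (m + 1) - z m ≤ 17 / 20 * a) ∧ z 0 = 0 ∧ (∀ y : EuclideanSpace ℝ (Fin 3), dist y (0 : EuclideanSpace ℝ (Fin 3)) ≤ 3 * a → μ {y} ≠ 0 → ∃ y' : EuclideanSpace ℝ (Fin 3), y' - (0 : EuclideanSpace ℝ (Fin 3)) ∈ {p | ∃ m i j : ℤ, p = A (((i : ℝ) • Literature.MathematicalPhysics.StatisticalMechanics.triangularVec₁ a) + ((j : ℝ) • Literature.MathematicalPhysics.StatisticalMechanics.triangularVec₂ a)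 + ((Literature.MathematicalPhysics.StatisticalMechanics.haggLabel s m : ℝ) • Literature.MathematicalPhysics.StatisticalMechanics.barlowOffset a) + (z m • Literature.MathematicalPhysics.StatisticalMechanics.layerNormal 1))} ∧ dist y y' ≤ η) ∧ (∀ y' : EuclideanSpace ℝ (Fin 3), y' - (0 : EuclideanSpace ℝ (Fin 3)) ∈ {p | ∃ m i j : ℤ, p = A (((i : ℝ) • Literature.MathematicalPhysics.StatisticalMechanics.triangularVec₁ a) + ((j : ℝ) • Literature.MathematicalPhysics.StatisticalMechanics.triangularVec₂ a) + ((Literature.MathematicalPhysics.StatisticalMechanics.haggLabel s m : ℝ) • Literature.MathematicalPhysics.StatisticalMechanics.barlowOffset a) + (z m • Literature.MathematicalPhysics.StatisticalMechanics.layerNormal 1))} → dist y' (0 : EuclideanSpace ℝ (Fin 3)) ≤ 4 * a → ∃ y : EuclideanSpace ℝ (Fin 3), μ {y} ≠ 0 ∧ dist y y' ≤ η))} = 0 → ∀ᵐ μ ∂P, ∀ q : EuclideanSpace ℝ (Fin 3), μ {q} ≠ 0 → ∃ (A : EuclideanSpace ℝ (Fin 3) →ₗᵢ[ℝ] EuclideanSpace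 ℝ (Fin 3)) (s : ℤ → ℤ) (z : ℤ → ℝ), Literature.MathematicalPhysics.StatisticalMechanics.IsHaggSeq s ∧ (∀ m : ℤ, 39 / 50 * a ≤ z (m + 1) - z m ∧ z (m + 1) - z m ≤ 17 / 20 * a) ∧ z 0 = 0 ∧ (∀ y : EuclideanSpace ℝ (Fin 3), dist y q ≤ 3 * a → μ {y} ≠ 0 → ∃ y' : EuclideanSpace ℝ (Fin 3), y' - q ∈ {p | ∃ m i j : ℤ, p = A (((i : ℝ) • Literature.MathematicalPhysics.StatisticalMechanics.triangularVec₁ a) + ((j : ℝ) • Literature.MathematicalPhysics.StatisticalMechanics.triangularVec₂ a) + ((Literature.MathematicalPhysics.StatisticalMechanics.haggLabel s m : ℝ) • Literature.MathematicalPhysics.StatisticalMechanics.barlowOffset a) + (z m • Literature.MathematicalPhysics.StatisticalMechanics.layerNormal 1))} ∧ dist y y' ≤ η) ∧ (∀ y' : EuclideanSpace ℝ (Fin 3), y' - q ∈ {p | ∃ m i j : ℤ, p = A (((i : ℝ) • Literature.MathematicalPhysics.StatisticalMechanics.triangularVec₁ a) + ((j : ℝ) • Literature.MathematicalPhysics.StatisticalMechanics.triangularVec₂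 a) + ((Literature.MathematicalPhysics.StatisticalMechanics.haggLabel s m : ℝ) • Literature.MathematicalPhysics.StatisticalMechanics.barlowOffset a) + (z m • Literature.MathematicalPhysics.StatisticalMechanics.layerNormal 1))} → dist y' q ≤ 4 * a → ∃ y : EuclideanSpace ℝ (Fin 3), μ {y} ≠ 0 ∧ dist y y' ≤ η) := by
  intro δ hδ P hP hroot hmecke a ha η hη hnull
  -- local finiteness of the norm shells, from the hard core
  have hlf : ∀ᵐ μ ∂P, ∀ n : ℕ, μ ((fun z : EuclideanSpace ℝ (Fin 3) => ⌊‖z‖⌋₊) ⁻¹' {n}) < ⊤ := by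
    filter_upwards [hroot] with μ hμ
    obtain ⟨S, -, hsep, rfl⟩ := hμ
    intro n
    rw [MeasureTheory.Measure.restrict_apply (Literature.Probability.Process.measurableSet_floorNorm_preimage n)]
    refine (MeasureTheory.measure_mono ?_).trans_lt (MeasureTheory.Measure.count_apply_lt_top.2
      (Literature.Probability.Process.LocalConfig.finite_inter_of_separated hδ hsep
        (isCompact_closedBall (0 : EuclideanSpace ℝ (Fin 3)) ((n : ℝ) + 1))))
    rintro w ⟨hw, hwS⟩
    exact ⟨Literature.Probability.Process.floorNorm_preimage_subset_closedBall n hw, hwS⟩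
  -- the root-matching property holds a.s.
  have hp := ae_iff.2 hnull
  -- Aldous–Lyons: it holds re-rooted at every point, a.s.
  have hstat : Literature.Probability.Process.IsPointStationaryLaw P := hmecke
  have key := hstat.ae_forall_map_sub hlf hp
  filter_upwards [key] with μ hμ q hq
  obtain ⟨A, s, z, hs, hgap, hz0, h1, h2⟩ := hμ q hq
  have hmap : ∀ y : EuclideanSpace ℝ (Fin 3),
      (MeasureTheory.Measure.map (fun w => w - q) μ) {y} = μ {y + q} := by
    intro y
    rw [MeasureTheory.Measure.map_apply (measurable_sub_const q) (measurableSet_singleton y)]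
    congr 1
    ext w
    simp only [Set.mem_preimage, Set.mem_singleton_iff, sub_eq_iff_eq_add]
  refine ⟨A, s, z, hs, hgap, hz0, ?_, ?_⟩
  · intro y hyq hyμ
    have hθ : (MeasureTheory.Measure.map (fun w => w - q) μ) {y - q} ≠ 0 := by
      rw [hmap, sub_add_cancel]; exact hyμ
    have hd0 : dist (y - q) (0 : EuclideanSpace ℝ (Fin 3)) ≤ 3 * a := by
      simpa [dist_eq_norm] using hyq
    obtain ⟨y', hy'S, hd⟩ := h1 (y - q) hd0 hθ
    refine ⟨y' + q, ?_, ?_⟩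
    · have e : y' + q - q = y' - 0 := by simp
      rw [e]; exact hy'S
    · calc dist y (y' + q) = dist (y - q) y' := by
            rw [dist_eq_norm, dist_eq_norm]; congr 1; abel
        _ ≤ η := hd
  · intro y' hy'S hd4
    have hy'S0 : y' - q - 0 ∈ {p : EuclideanSpace ℝ (Fin 3) | ∃ m i j : ℤ, p = A (((i : ℝ) • Literature.MathematicalPhysics.StatisticalMechanics.triangularVec₁ a) + ((j : ℝ) • Literature.MathematicalPhysics.StatisticalMechanics.triangularVec₂ a) + ((Literature.MathematicalPhysics.StatisticalMechanics.haggLabel s m : ℝ) • Literature.MathematicalPhysics.StatisticalMechanics.barlowOffset a) + (z m • Literature.MathematicalPhysics.StatisticalMechanics.layerNormal 1))} := by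
      rw [sub_zero]; exact hy'S
    have hd0 : dist (y' - q) (0 : EuclideanSpace ℝ (Fin 3)) ≤ 4 * a := by
      simpa [dist_eq_norm] using hd4
    obtain ⟨y, hyμ, hd⟩ := h2 (y' - q) hy'S0 hd0
    refine ⟨y + q, ?_, ?_⟩
    · rw [← hmap]; exact hyμ
    · calc dist (y + q) y' = dist y (y' - q) := by
            rw [dist_eq_norm, dist_eq_norm]; congr 1; abel
        _ ≤ η := hd

end Summit.AtomisticToContinuum.Crystallization.Theorems.ChartedPlanarOrderEveryPointOfRoot
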